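import Mathlib
import HarnessLib

/-!
# The quotient of a regular variety by a REGULAR rank-one `1`-foliation is regular (Posva, Lemma 2.37 ⇐)

Topic: `Literature/RingTheory/Derivation` (commutative algebra of `p`-closed derivations; companion of
`MultiplicativeDerivationNormalForm` (Posva Prop. 4.1), `PClosedTaylor`, `SliceDecomposition`).
Source: Q. Posva, *On the singularities of quotients by 1-foliations*, Nagoya Math. J. **261** (2026) e6,
1–41, doi:10.1017/nmj.2025.10072 (bib key `Posva2023`; journal PDF deposited by cell res-hironaka seat
res-lit-3, `HOME/lit/res-lit-3/posva/posva_nmj.pdf`, sha256 `d22b9f5cccbff23b…`, text layer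
`text/posva_nmj/plain/pNNNN.txt`, locators below = journal page + line of that text layer) = arXiv:2311.16694
(held as corpus `paper:arxiv-2311.16694`, v1, where the result is **Lemma 9**, chunk p0012 L9–L10, stated for
«a regular `k`-scheme of finite type»).

PRINTED STATEMENT (journal p. 16 L20–L22, verbatim): «Lemma 2.37 [46, Part I, III.1.9]. Let `X` be a smooth
`k`-scheme, `𝓕` a `1`-foliation on `X`. Then `X/𝓕` is regular if and only if `𝓕` is regular.» Here ([46] =
Miyaoka–Peternell; the source's conventions): `k` is a perfect field of characteristic `p > 0` (§2.1, p. 4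
L15 «Unless stated otherwise, we work over a perfect field k of positive characteristic p > 0»); a
*foliation* on a normal connected `k`-scheme of finite type is a coherent subsheaf `𝓕 ⊆ T_{X/k}` which is
saturated and closed under Lie brackets, a *`1`-foliation* one that is also closed under `p`-th powers
(Def. 2.14, p. 10 L5–L8); `D ∈ Der_R(A)` is *`p`-closed* if `D^[p] = aD` for some `a ∈ A`, `D^[p]` the
`p`-fold composite (§2.3.1, p. 7 L20–L22); `𝓕` is *regular at `x`* if `𝒪_{X,x}` is regular and
`T_{X/k}/𝓕` is locally free at `x` (Def. 2.17, p. 10 L23–L26); the *quotient* is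
`X/𝓕 = (|X|, 𝒪_X^𝓕)`, `𝒪_X^𝓕(U) = {s ∈ 𝒪_X(U) | D(s) = 0 ∀ D ∈ 𝓕(U)}` (Def. 2.34, p. 15 L4–L16), and
quotients localise: `(A^𝓕)_𝔮 = (A_𝔭)^{𝓕_𝔭}` for `A` normal Noetherian `F`-finite (Lemma 2.35 (2), p. 15
L21–L25). Printed proof of ⇐ (p. 16 L24–L39): localise at a point; by Lemma 2.18 (Seshadri, Yuan; p. 10
L31–L41) a regular `1`-foliation of rank `r` on a regular local `A` essentially of finite type over `k` is
`𝓕 = ⊕_{i ≤ r} A·Dᵢ` in suitable local coordinates, and then `A^𝓕` is regular (Remark 2.38: «completion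
is not needed»).

WHAT IS TYPED (direction ⇐ only, RANK ONE, read at a point — the form requested by the L-lane W4.1 of cell
res-hironaka, WANTED FACT F-E1 2026-08-27): for `k` perfect of characteristic `p`, `A` a regular local ring
essentially of finite type over `k` (= `𝒪_{X,x}`, `X` smooth over `k`), and `D ∈ Der_k(A)` which is
`p`-closed («`D^[p] = aD`») and takes a UNIT value (`D f ∈ Aˣ` for some `f`), the ring of constants
`A^D = {c ∈ A | D c = 0}` is a regular local ring. RELATION TO PRINT (a special case, read through the
source's own definitions; nothing stronger than print): `A·D ⊆ Der_k(A)` is the stalk at `x` of a rank-one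
`1`-foliation `𝓕` near `x` (Lie-closed automatically; `p`-closed because `D^[p] = aD` and Hochschild's
formula; SATURATED with `Der_k(A)/A·D` FREE — i.e. `𝓕` regular at `x` in the sense of Def. 2.17 — exactly
because `D` has a unit value: `Der_k(A) = Hom_A(Ω¹_{A/k}, A)` is free on the duals of exact differentials
`dy₁,…,dy_n`, and `D = Σ D(yⱼ)·∂ⱼ` is part of a basis iff some `D(yⱼ) ∉ 𝔪`, iff `D(A) ⊄ 𝔪`); and the
local ring of `X/𝓕` at `q(x)` is `(A)^{𝓕_x} = A^D` by Lemma 2.35 (2) (`A` is `F`-finite since `k` is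
perfect). So the typed statement is Lemma 2.37 ⇐ for `rk 𝓕 = 1`, at one point. The converse direction ⇒,
ranks `r ≥ 2`, and the global scheme statement are not typed. -- TODO(general form): rank `r` (a family
`D₁,…,D_r` spanning a free direct summand, pairwise-bracket- and `p`-closed), the global `X/𝓕`, direction ⇒.

The conclusion is phrased OBJECT-FREE — for every subring `B ⊆ A` whose carrier is `{c | D c = 0}` — so
that consumers instantiate it with their own ring of constants (e.g. the tree's
`Literature.Algebra.Polynomial.HermiteReduction.ringOfConstants D`, or an `R ∩ K^p`-style subring of a
function field); `IsRegularLocalRing` is Mathlib's (local ∧ Noetherian ∧ `μ(𝔪) = dim`).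

NAMED FACT, statement only (`def … : Prop`); users take `(h : Posva2023_Lemma_2_37_rank1)`. Not a
Hironaka-2017 claim; a published, refereed lemma (the source attributes it to Miyaoka–Peternell and proves
it via Seshadri–Yuan normal form / Kunz). References: [cite: Posva2023, Lemma 2.37 p. 16 (⇐), Def. 2.14 /
2.17 p. 10, §2.3.1 p. 7, Def. 2.34 / Lemma 2.35 p. 15, Lemma 2.18 p. 10]; arXiv:2311.16694v1 Lemma 9
(chunk p0012 L9–L10).
-/

noncomputable section

open IsLocalRing

namespace Literature.RingTheory.Derivation

universe u v

/-- NAMED FACT — **Posva, Nagoya Math. J. 261 (2026) e6, Lemma 2.37, direction ⇐, rank one, at a point**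
(journal p. 16 L20–L22: «Let `X` be a smooth `k`-scheme, `𝓕` a `1`-foliation on `X`. Then `X/𝓕` is regular
if and only if `𝓕` is regular.»; = arXiv:2311.16694v1 Lemma 9). Typed (module docstring for the
dictionary with Def. 2.14 / 2.17 / 2.34 and Lemma 2.35 (2)): for every prime `p`, perfect field `k` of
characteristic `p`, regular local ring `A` essentially of finite type over `k`, and `k`-derivation `D` of
`A` that is `p`-closed (`∃ a, D^[p] = a·D`, §2.3.1 p. 7) and has a unit value (`∃ f, D f ∈ Aˣ` — the
rank-one foliation `A·D` is regular at the closed point, Def. 2.17), every subring `B` of `A` with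
`B = {c | D c = 0}` (the ring of constants `A^D`, Def. 2.34 at the stalk) is a regular local ring
(Mathlib `IsRegularLocalRing`: local, Noetherian, `μ(𝔪_B) = dim B`). Direction ⇒, higher rank and the
global statement are not typed. Statement only; users take `(h : Posva2023_Lemma_2_37_rank1)`.
[cite: Posva2023, Lemma 2.37 p. 16 (⇐); Def. 2.17 p. 10; Def. 2.34, Lemma 2.35 (2) p. 15] -/
def Posva2023_Lemma_2_37_rank1 : Prop :=
  ∀ (p : ℕ) [Fact p.Prime] (k : Type u) [Field k] [CharP k p] [PerfectField k]
    (A : Type v) [CommRing A] [Algebra k A] [IsRegularLocalRing A] [Algebra.EssFiniteType k A]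
    (D : _root_.Derivation k A A),
    (∃ a : A, ∀ b : A, (⇑D)^[p] b = a * D b) →
    (∃ f : A, IsUnit (D f)) →
    ∀ (B : Subring A), (∀ c : A, c ∈ B ↔ D c = 0) → IsRegularLocalRing B

/-! ### Elementary API around the hypotheses (proved; not part of the fact) -/

/-- In characteristic `p`, `p`-th powers are constants of any derivation: `D (b^p) = p·b^{p-1}·D b = 0`.
(The source: «`A^D` … contains `nil(A)` and `A^p`», §2.5.1 p. 14 / arXiv chunk p0010 L62.)
[cite: Posva2023, §2.5.1 (A^p ⊆ A^D)] -/
theorem apply_pow_char_eq_zero {R A : Type*} [CommRing R] [CommRing A] [Algebra R A] (p : ℕ) [CharP A p]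
    (D : _root_.Derivation R A A) (b : A) : D (b ^ p) = 0 := by
  rw [D.leibniz_pow, ← Nat.cast_smul_eq_nsmul A p, CharP.cast_eq_zero A p, zero_smul]

/-- Hence every `p`-th power lies in a ring of constants `B = {c | D c = 0}` (the shape of the fact's
conclusion): `A^p ⊆ A^D`. [cite: Posva2023, §2.5.1 (A^p ⊆ A^D)] -/
theorem pow_char_mem_of_forall_mem_iff {R A : Type*} [CommRing R] [CommRing A] [Algebra R A] (p : ℕ)
    [CharP A p] (D : _root_.Derivation R A A) {B : Subring A} (hB : ∀ c : A, c ∈ B ↔ D c = 0) (b : A) :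
    b ^ p ∈ B :=
  (hB _).2 (apply_pow_char_eq_zero p D b)

/-- A derivation with a unit value is not the zero derivation (the regular rank-one case excludes `D = 0`).
[cite: Posva2023, Def. 2.17 p. 10] -/
theorem ne_zero_of_isUnit_apply {R A : Type*} [CommRing R] [CommRing A] [Algebra R A] [Nontrivial A]
    (D : _root_.Derivation R A A) {f : A} (hf : IsUnit (D f)) : D ≠ 0 := by
  rintro rfl
  simp at hf

end Literature.RingTheory.Derivation

end
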